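import Mathlib.Algebra.BigOperators.Finprod
import Mathlib.Algebra.Order.BigOperators.Group.Finset
import Mathlib.Data.Set.Card
import Mathlib.Tactic

/-!
# [EtTh] §5, proof of Proposition 5.3 (iv)–(vi): the combinatorial core of "the well-known intersection theory of
# divisors supported on the chain of copies of the projective line" (pp. 326–327 / PDF pp. 100–101) — PROVED

Mochizuki, *The étale theta function …*, Publ. RIMS **45** (2009), proof of Prop. 5.3, p.326 (PDF p.100):
"(iv), (v), and (vi) follow by considering the well-known intersection theory of divisors supported on the chain
of copies of the projective line that constitutes the special fiber of `Ÿ`" [cite: MochizukiEtTh2009, Prop 5.3 proof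
p.326–327 (PDF pp.100–101)].

WHAT IS HERE (hypothesis-free combinatorics; no Frobenioid vocabulary).  The special fibre is modelled by its dual
data only: irreducible components labelled by `ℤ` (the "chain"), a type `K` of cusps and the map `π : K → ℤ`
sending a cusp to the component it lies on (surjective at the genuine data: every component carries cusps).  A
cuspidal divisor is an order function `h : K → ℚ`, its support possibly INFINITE (cf. [EtTh] Prop. 3.2 (i), p.296:
`DIV₊` is a direct PRODUCT); its degree over the component `n_i` is the `finsum` `cuspDeg π h i` of its orders at
the cusps on `n_i`.  Under the intersection-number description of principal divisors ("`x` principal iff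
`ord_{i−1} x − 2·ord_i x + ord_{i+1} x + (cuspidal degree over i) = 0` for every component `n_i`", orders along
components in units of the Cartier generators), a cuspidal divisor is linearly equivalent to `m · n_j` iff its
degrees are `m · stencil j` (`stencil` = the second difference of the indicator of `j`: `−2` at `j`, `1` at
`j ± 1`), to `m · (n_p + n_q)` iff its degrees are `m · (stencil p + stencil q)`, and two finitely supported cuspidal
divisors are linearly equivalent iff they have the same degrees (`cuspDeg_sub`).  Everything below is stated for
degrees `c · stencil …` with an arbitrary non-zero (resp. positive) rational `c`, so it is insensitive to the
normalisation of the intersection pairing.  We prove: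
* `ncard_stencilSupport_*` — the count behind "4 versus 5 or 6" (p.327): the components meeting `n_p + n_q`
  non-trivially are `4`, `5`, `6` in number according as `|p − q| = 1`, `= 2`, `≥ 3`;
* `encard_le_of_cuspDeg_ne_zero` / `IsDegMinimal.encard_support_eq` — a cuspidal divisor with prescribed non-zero
  degrees over a set `N` of components has at least `|N|` cusps in its support, and the minimal ones ("cuspidally
  minimal", p.326, compared by possibly-infinite cardinality `Set.encard`; equivalently against finitely supported
  competitors only, `isDegMinimal_iff_finite`) have exactly `|N|`; they exist (`exists_isDegMinimal`); the
  competitor-relative forms `HasDegrees.encard_support_eq_of_le` / `.ncard_support_eq_stencilSupport` /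
  `incidence_structure_of_le` only compare with the explicit one-cusp-per-component competitor `ofSection`, for
  consumers whose minimality ranges over a restricted class of competitors (those realised in `Φ(A_⊚)^gp`);
* the three printed criteria themselves (adjacency "4 versus 5 or 6" of (v), the description of the surjection of
  (iv), the incidence sentence "`n ∼ n₁ + n₂ − a`") are derived in the proof-only companion
  `ChainDivisorCriteria.lean`.
Consumers (the repaired divisor-support data `FrobenioidThetaDivisors.DivisorSupportData'` with its explicit
intersection-number binder, GAP-LEDGER G-L2d4-2) supply the dictionary `Φ(A_⊚)^gp →` order functions; nothing here
takes a side on anything downstream; Prop. 5.3 is classical and undisputed.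
-/

namespace Literature.AnabelianGeometry.EtaleTheta.ChainDivisors

open Set Function

/-! ### The second-difference stencil of a component and the "4 / 5 / 6" count -/

/-- The intersection numbers of the component `n_p` of the chain with the components `n_i`, in units of
`n_p · n_{p±1}`: `−2` at `i = p`, `1` at `i = p ± 1`, `0` elsewhere (the second-difference stencil).
[cite: MochizukiEtTh2009, Prop 5.3 proof p.326 (PDF p.100)] -/
def stencil (p i : ℤ) : ℤ := if i = p then -2 else if i = p - 1 ∨ i = p + 1 then 1 else 0

/-- The components meeting `n_p + n_q` non-trivially. [cite: MochizukiEtTh2009, Prop 5.3 proof p.327 (PDF p.101)] -/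
def stencilSupport (p q : ℤ) : Set ℤ := {i | stencil p i + stencil q i ≠ 0}

/-- The components meeting `n_p + n_q` lie among `p−1, p, p+1, q−1, q, q+1`.
[cite: MochizukiEtTh2009, Prop 5.3 proof p.327 (PDF p.101)] -/
theorem stencilSupport_subset (p q : ℤ) :
    stencilSupport p q ⊆ {p - 1, p, p + 1, q - 1, q, q + 1} := by
  intro i hi
  simp only [stencilSupport, stencil, mem_setOf_eq] at hi
  simp only [mem_insert_iff, mem_singleton_iff]
  split_ifs at hi <;> omega

/-- `stencilSupport p q` is finite. [cite: MochizukiEtTh2009, Prop 5.3 proof p.327 (PDF p.101)] -/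
theorem stencilSupport_finite (p q : ℤ) : (stencilSupport p q).Finite :=
  (((((finite_singleton (q + 1)).insert q).insert (q - 1)).insert (p + 1)).insert p).insert (p - 1) |>.subset
    (stencilSupport_subset p q)

/-- Adjacent components (`|p − q| = 1`): exactly `p−1, p, q, q+1` (for `q = p + 1`) meet `n_p + n_q` non-trivially.
[cite: MochizukiEtTh2009, Prop 5.3 proof p.327 (PDF p.101)] -/
theorem stencilSupport_of_eq_add_one {p q : ℤ} (h : q = p + 1) :
    stencilSupport p q = {p - 1, p, p + 1, p + 2} := by
  ext i
  simp only [stencilSupport, stencil, mem_setOf_eq, mem_insert_iff, mem_singleton_iff]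
  split_ifs <;> omega

/-- Components at distance `2` (`q = p + 2`): exactly `p−1, …, p+3` meet `n_p + n_q` non-trivially.
[cite: MochizukiEtTh2009, Prop 5.3 proof p.327 (PDF p.101)] -/
theorem stencilSupport_of_eq_add_two {p q : ℤ} (h : q = p + 2) :
    stencilSupport p q = {p - 1, p, p + 1, p + 2, p + 3} := by
  ext i
  simp only [stencilSupport, stencil, mem_setOf_eq, mem_insert_iff, mem_singleton_iff]
  split_ifs <;> omega

/-- Components at distance `≥ 3`: all six of `p−1, p, p+1, q−1, q, q+1` meet `n_p + n_q` non-trivially.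
[cite: MochizukiEtTh2009, Prop 5.3 proof p.327 (PDF p.101)] -/
theorem stencilSupport_of_three_le {p q : ℤ} (h : 3 ≤ |p - q|) :
    stencilSupport p q = {p - 1, p, p + 1, q - 1, q, q + 1} := by
  have h' : 3 ≤ p - q ∨ 3 ≤ q - p := by
    rcases le_abs.mp h with h | h
    · exact Or.inl h
    · exact Or.inr (by linarith)
  ext i
  simp only [stencilSupport, stencil, mem_setOf_eq, mem_insert_iff, mem_singleton_iff]
  split_ifs <;> omega

/-- `stencilSupport` is symmetric in `p, q`. [cite: MochizukiEtTh2009, Prop 5.3 proof p.327 (PDF p.101)] -/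
theorem stencilSupport_comm (p q : ℤ) : stencilSupport p q = stencilSupport q p := by
  ext i
  simp only [stencilSupport, mem_setOf_eq, add_comm]

/-- **"4"**: adjacent components meet `n_p + n_q` in exactly four components.
[cite: MochizukiEtTh2009, Prop 5.3 proof p.327 (PDF p.101)] -/
theorem ncard_stencilSupport_of_abs_eq_one {p q : ℤ} (h : |p - q| = 1) : (stencilSupport p q).ncard = 4 := by
  wlog hpq : q = p + 1 generalizing p q
  · have hqp : p = q + 1 := by
      rcases abs_eq (by norm_num : (0 : ℤ) ≤ 1) |>.mp h with h1 | h1 <;> omega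
    rw [stencilSupport_comm]
    exact this (by rw [abs_sub_comm]; exact h) hqp
  rw [stencilSupport_of_eq_add_one hpq]
  rw [ncard_insert_of_notMem (by simp only [mem_insert_iff, mem_singleton_iff]; omega), ncard_insert_of_notMem (by simp only [mem_insert_iff, mem_singleton_iff]; omega),
    ncard_insert_of_notMem (by simp only [mem_singleton_iff]; omega), ncard_singleton]

/-- **"5"**: components at distance two meet `n_p + n_q` in exactly five components.
[cite: MochizukiEtTh2009, Prop 5.3 proof p.327 (PDF p.101)] -/
theorem ncard_stencilSupport_of_abs_eq_two {p q : ℤ} (h : |p - q| = 2) : (stencilSupport p q).ncard = 5 := by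
  wlog hpq : q = p + 2 generalizing p q
  · have hqp : p = q + 2 := by
      rcases abs_eq (by norm_num : (0 : ℤ) ≤ 2) |>.mp h with h1 | h1 <;> omega
    rw [stencilSupport_comm]
    exact this (by rw [abs_sub_comm]; exact h) hqp
  rw [stencilSupport_of_eq_add_two hpq]
  rw [ncard_insert_of_notMem (by simp only [mem_insert_iff, mem_singleton_iff]; omega), ncard_insert_of_notMem (by simp only [mem_insert_iff, mem_singleton_iff]; omega),
    ncard_insert_of_notMem (by simp only [mem_insert_iff, mem_singleton_iff]; omega), ncard_insert_of_notMem (by simp only [mem_singleton_iff]; omega), ncard_singleton]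

/-- **"6"**: components at distance at least three meet `n_p + n_q` in exactly six components.
[cite: MochizukiEtTh2009, Prop 5.3 proof p.327 (PDF p.101)] -/
theorem ncard_stencilSupport_of_three_le {p q : ℤ} (h : 3 ≤ |p - q|) : (stencilSupport p q).ncard = 6 := by
  have h' : 3 ≤ p - q ∨ 3 ≤ q - p := by
    rcases le_abs.mp h with h | h
    · exact Or.inl h
    · exact Or.inr (by linarith)
  rw [stencilSupport_of_three_le h]
  rw [ncard_insert_of_notMem (by simp only [mem_insert_iff, mem_singleton_iff]; omega), ncard_insert_of_notMem (by simp only [mem_insert_iff, mem_singleton_iff]; omega),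
    ncard_insert_of_notMem (by simp only [mem_insert_iff, mem_singleton_iff]; omega), ncard_insert_of_notMem (by simp only [mem_insert_iff, mem_singleton_iff]; omega),
    ncard_insert_of_notMem (by simp only [mem_singleton_iff]; omega), ncard_singleton]

/-- For `p ≠ q` the three cases are exhaustive: the count is `4` iff `|p − q| = 1`, and otherwise it is `5` or `6`.
[cite: MochizukiEtTh2009, Prop 5.3 proof p.327 (PDF p.101)] -/
theorem ncard_stencilSupport_eq_four_iff {p q : ℤ} (hpq : p ≠ q) :
    ((stencilSupport p q).ncard = 4 ↔ |p - q| = 1) ∧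
      (((stencilSupport p q).ncard = 5 ∨ (stencilSupport p q).ncard = 6) ↔ |p - q| ≠ 1) := by
  have hpos : 0 < |p - q| := abs_pos.mpr (sub_ne_zero.mpr hpq)
  rcases lt_trichotomy |p - q| 2 with hlt | heq | hgt
  · have h1 : |p - q| = 1 := by omega
    simp [ncard_stencilSupport_of_abs_eq_one h1, h1]
  · simp [ncard_stencilSupport_of_abs_eq_two heq, heq]
  · have h3 : 3 ≤ |p - q| := by omega
    refine ⟨⟨fun h => ?_, fun h => ?_⟩, ⟨fun _ => by omega, fun _ => Or.inr (ncard_stencilSupport_of_three_le h3)⟩⟩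
    · rw [ncard_stencilSupport_of_three_le h3] at h; omega
    · omega

/-! ### Cuspidal degrees over a component (possibly infinite supports: `finsum` semantics) -/

variable {K : Type*} (π : K → ℤ)

/-- The cuspidal degree of `h` over the component `i`: the sum of the orders of `h` at the cusps lying on `n_i`
(a `finsum`; the genuine fibres are finite). [cite: MochizukiEtTh2009, Prop 5.3 proof p.326 (PDF p.100)] -/
noncomputable def cuspDeg (h : K → ℚ) (i : ℤ) : ℚ := ∑ᶠ k ∈ π ⁻¹' {i}, h k

/-- A non-zero cuspidal degree over `i` is witnessed by a cusp on `n_i` in the support.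
[cite: MochizukiEtTh2009, Prop 5.3 proof p.326 (PDF p.100)] -/
theorem exists_mem_support_of_cuspDeg_ne_zero {h : K → ℚ} {i : ℤ} (hi : cuspDeg π h i ≠ 0) :
    ∃ k, π k = i ∧ h k ≠ 0 := by
  obtain ⟨k, hk, hk'⟩ := exists_ne_zero_of_finsum_mem_ne_zero hi
  exact ⟨k, hk, hk'⟩

/-- A negative cuspidal degree over `i` is witnessed by a cusp on `n_i` of negative order.
[cite: MochizukiEtTh2009, Prop 5.3 proof p.326 (PDF p.100)] -/
theorem exists_neg_of_cuspDeg_neg {h : K → ℚ} {i : ℤ} (hi : cuspDeg π h i < 0) :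
    ∃ k, π k = i ∧ h k < 0 := by
  by_contra! hcon
  have : 0 ≤ cuspDeg π h i := by
    rw [cuspDeg, finsum_mem_def]
    refine finsum_nonneg fun k => ?_
    by_cases hk : k ∈ π ⁻¹' {i}
    · rw [indicator_of_mem hk]; exact hcon k hk
    · rw [indicator_of_notMem hk]
  exact absurd hi (not_lt.mpr this)

/-- If the only cusp on `n_i` at which `h` is non-zero is `k₀`, the degree over `i` is `h k₀`.
[cite: MochizukiEtTh2009, Prop 5.3 proof p.326 (PDF p.100)] -/
theorem cuspDeg_eq_of_unique {h : K → ℚ} {i : ℤ} {k₀ : K} (hk₀ : π k₀ = i)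
    (huniq : ∀ k, π k = i → h k ≠ 0 → k = k₀) : cuspDeg π h i = h k₀ := by
  rw [cuspDeg, finsum_mem_inter_support_eq h (π ⁻¹' {i}) {k₀}, finsum_mem_singleton]
  ext k
  simp only [mem_inter_iff, mem_preimage, mem_singleton_iff, mem_support]
  constructor
  · rintro ⟨hk, hk'⟩; exact ⟨huniq k hk hk', hk'⟩
  · rintro ⟨rfl, hk'⟩; exact ⟨hk₀, hk'⟩

/-- If `h` vanishes at every cusp on `n_i`, its degree over `i` is `0`.
[cite: MochizukiEtTh2009, Prop 5.3 proof p.326 (PDF p.100)] -/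
theorem cuspDeg_eq_zero_of_forall {h : K → ℚ} {i : ℤ} (h0 : ∀ k, π k = i → h k = 0) : cuspDeg π h i = 0 := by
  by_contra hne
  obtain ⟨k, hk, hk'⟩ := exists_mem_support_of_cuspDeg_ne_zero π hne
  exact hk' (h0 k hk)

/-- For finitely supported divisors the cuspidal degree is additive (in difference form: the degrees of `y − x`,
whose vanishing is the cuspidal part of "`y` linearly equivalent to `x`").
[cite: MochizukiEtTh2009, Prop 5.3 proof p.326 (PDF p.100)] -/
theorem cuspDeg_sub {x y : K → ℚ} (hy : (support y).Finite) (hx : (support x).Finite) (i : ℤ) :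
    cuspDeg π (y - x) i = cuspDeg π y i - cuspDeg π x i := by
  have hy' : HasFiniteSupport ((π ⁻¹' {i}).indicator y) :=
    hy.subset (by rw [support_indicator]; exact inter_subset_right)
  have hx' : HasFiniteSupport ((π ⁻¹' {i}).indicator x) :=
    hx.subset (by rw [support_indicator]; exact inter_subset_right)
  simp only [cuspDeg, finsum_mem_def]
  rw [indicator_sub']
  exact finsum_sub_distrib hy' hx'

/-! ### Minimal supports for prescribed degrees ("cuspidally minimal", p.326) -/

/-- **Lower bound.** If the cuspidal degrees of `h` are non-zero over every component in `N`, the support of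
`h` has at least `|N|` cusps (one on each such component; cardinalities in `ℕ∞`, supports may be infinite).
[cite: MochizukiEtTh2009, Prop 5.3 proof p.326–327 (PDF pp.100–101)] -/
theorem encard_le_of_cuspDeg_ne_zero {h : K → ℚ} {N : Set ℤ} (hN : ∀ i ∈ N, cuspDeg π h i ≠ 0) :
    N.encard ≤ (support h).encard := by
  classical
  rcases N.eq_empty_or_nonempty with rfl | ⟨i₀, hi₀⟩
  · simp
  choose k hk using fun i : N => exists_mem_support_of_cuspDeg_ne_zero π (hN i i.2)
  let f : ℤ → K := fun i => if hi : i ∈ N then k ⟨i, hi⟩ else k ⟨i₀, hi₀⟩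
  have hfπ : ∀ i ∈ N, π (f i) = i := fun i hi => by simp only [f, dif_pos hi]; exact (hk ⟨i, hi⟩).1
  have hmaps : MapsTo f N (support h) := fun i hi => by
    simp only [f, dif_pos hi, mem_support]; exact (hk ⟨i, hi⟩).2
  have hinj : InjOn f N := fun i hi j hj hij => by rw [← hfπ i hi, ← hfπ j hj, hij]
  exact encard_le_encard_of_injOn hmaps hinj

/-! ### Realising prescribed degrees with one cusp per component -/

open Classical in
/-- Given a choice `s` of one cusp on each component and prescribed degrees `R`, the cuspidal divisor with order
`R i` at the chosen cusp `s i` and `0` at every other cusp (the competitors realising "minimal cardinality",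
p.326). [cite: MochizukiEtTh2009, Prop 5.3 proof p.326 (PDF p.100)] -/
noncomputable def ofSection (s : ℤ → K) (R : ℤ → ℚ) (k : K) : ℚ := if s (π k) = k then R (π k) else 0

section OfSection

variable {π} {s : ℤ → K} (hs : ∀ i, π (s i) = i) (R : ℤ → ℚ)
include hs

/-- `ofSection` has order `R i` at the chosen cusp of `n_i`. [cite: MochizukiEtTh2009, Prop 5.3 proof p.326 (PDF p.100)] -/
theorem ofSection_apply_section (i : ℤ) : ofSection π s R (s i) = R i := by
  simp [ofSection, hs i]

/-- The support of `ofSection` is the set of chosen cusps on the components where `R ≠ 0`.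
[cite: MochizukiEtTh2009, Prop 5.3 proof p.326 (PDF p.100)] -/
theorem support_ofSection : support (ofSection π s R) = s '' {i | R i ≠ 0} := by
  ext k
  simp only [mem_support, ofSection, ne_eq, ite_eq_right_iff, Classical.not_imp, mem_image, mem_setOf_eq]
  constructor
  · rintro ⟨hk, hR⟩
    exact ⟨π k, hR, hk⟩
  · rintro ⟨i, hR, rfl⟩
    rw [hs i]
    exact ⟨rfl, hR⟩

/-- The cuspidal degrees of `ofSection π s R` are `R`. [cite: MochizukiEtTh2009, Prop 5.3 proof p.326 (PDF p.100)] -/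
theorem cuspDeg_ofSection (i : ℤ) : cuspDeg π (ofSection π s R) i = R i := by
  rw [cuspDeg_eq_of_unique π (hs i), ofSection_apply_section hs]
  intro k hk hne
  by_contra hks
  apply hne
  simp only [ofSection]
  exact if_neg (by rw [hk]; exact Ne.symm hks)

/-- The support of `ofSection π s R` has the cardinality of `{i | R i ≠ 0}`.
[cite: MochizukiEtTh2009, Prop 5.3 proof p.326 (PDF p.100)] -/
theorem encard_support_ofSection : (support (ofSection π s R)).encard = {i | R i ≠ 0}.encard := by
  rw [support_ofSection hs]
  have hinj : InjOn s {i | R i ≠ 0} := fun i _ j _ hij => by rw [← hs i, ← hs j, hij]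
  exact hinj.encard_image

end OfSection

/-! ### Degree-minimal cuspidal divisors ("cuspidally minimal", p.326) -/

/-- `h` has cuspidal degrees `R` over every component (for two cuspidal divisors, having the same degrees is
linear equivalence under the intersection-number description of principal divisors).
[cite: MochizukiEtTh2009, Prop 5.3 proof p.326 (PDF p.100)] -/
def HasDegrees (R : ℤ → ℚ) (h : K → ℚ) : Prop := ∀ i, cuspDeg π h i = R i

/-- "cuspidally minimal" (p.326: "whose support … is a finite set of minimal cardinality among the cardinalities of
supports of cuspidal elements … linearly equivalent to the given element"), for the class of cuspidal divisors with
degrees `R`; cardinalities are compared in `ℕ∞` (`Set.encard`), so that infinitely supported competitors count as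
larger, as in print. [cite: MochizukiEtTh2009, Prop 5.3 proof p.326 (PDF p.100)] -/
def IsDegMinimal (R : ℤ → ℚ) (h : K → ℚ) : Prop :=
  HasDegrees π R h ∧ (support h).Finite ∧ ∀ h', HasDegrees π R h' → (support h).encard ≤ (support h').encard

variable {π}

/-- Every divisor with degrees `R` has at least `|{i | R i ≠ 0}|` cusps in its support.
[cite: MochizukiEtTh2009, Prop 5.3 proof p.326–327 (PDF pp.100–101)] -/
theorem HasDegrees.encard_le {R : ℤ → ℚ} {h : K → ℚ} (hh : HasDegrees π R h) :
    {i | R i ≠ 0}.encard ≤ (support h).encard :=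
  encard_le_of_cuspDeg_ne_zero π fun i hi => by rw [hh i]; exact hi

/-- **The count, relative to the one-cusp-per-component competitor.**  If `h` has degrees `R` and its support is
no larger (in `ℕ∞`) than that of `ofSection π s R` for some choice `s` of a cusp on each component, then its
support has exactly `|{i | R i ≠ 0}|` cusps.  This is the form needed by consumers whose "cuspidally minimal"
quantifies over a restricted class of competitors (e.g. those realised in `Φ(A_⊚)^gp`) that contains
`ofSection π s R`.  [cite: MochizukiEtTh2009, Prop 5.3 proof p.326–327 (PDF pp.100–101)] -/
theorem HasDegrees.encard_support_eq_of_le {R : ℤ → ℚ} {h : K → ℚ} (hh : HasDegrees π R h) {s : ℤ → K}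
    (hs : ∀ i, π (s i) = i) (hle : (support h).encard ≤ (support (ofSection π s R)).encard) :
    (support h).encard = {i | R i ≠ 0}.encard :=
  le_antisymm (by rwa [encard_support_ofSection hs] at hle) hh.encard_le

/-- The same count in `ℕ`. [cite: MochizukiEtTh2009, Prop 5.3 proof p.326–327 (PDF pp.100–101)] -/
theorem HasDegrees.ncard_support_eq_of_le {R : ℤ → ℚ} {h : K → ℚ} (hh : HasDegrees π R h) {s : ℤ → K}
    (hs : ∀ i, π (s i) = i) (hle : (support h).encard ≤ (support (ofSection π s R)).encard) :
    (support h).ncard = {i | R i ≠ 0}.ncard := by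
  rw [ncard_def, ncard_def, hh.encard_support_eq_of_le hs hle]

/-- One cusp per component realises the minimum: `ofSection π s R` is degree-minimal whenever `R` has finite
support. [cite: MochizukiEtTh2009, Prop 5.3 proof p.326 (PDF p.100)] -/
theorem isDegMinimal_ofSection {s : ℤ → K} (hs : ∀ i, π (s i) = i) {R : ℤ → ℚ} (hR : {i | R i ≠ 0}.Finite) :
    IsDegMinimal π R (ofSection π s R) := by
  refine ⟨cuspDeg_ofSection hs R, ?_, fun h' hh' => ?_⟩
  · rw [support_ofSection hs]
    exact hR.image s
  · rw [encard_support_ofSection hs]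
    exact hh'.encard_le

/-- Degree-minimal divisors exist as soon as every component carries a cusp and `R` has finite support.
[cite: MochizukiEtTh2009, Prop 5.3 proof p.326 (PDF p.100)] -/
theorem exists_isDegMinimal (hπ : Surjective π) {R : ℤ → ℚ} (hR : {i | R i ≠ 0}.Finite) :
    ∃ h, IsDegMinimal π R h :=
  ⟨_, isDegMinimal_ofSection (surjInv_eq hπ) hR⟩

/-- **The cardinality of a cuspidally minimal support**: a degree-minimal divisor has exactly one cusp on each
component where `R ≠ 0` and none elsewhere — its support has cardinality `|{i | R i ≠ 0}|`.
[cite: MochizukiEtTh2009, Prop 5.3 proof p.326–327 (PDF pp.100–101)] -/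
theorem IsDegMinimal.encard_support_eq (hπ : Surjective π) {R : ℤ → ℚ} {h : K → ℚ} (hmin : IsDegMinimal π R h) :
    (support h).encard = {i | R i ≠ 0}.encard := by
  refine le_antisymm ?_ hmin.1.encard_le
  rw [← encard_support_ofSection (surjInv_eq hπ) R]
  exact hmin.2.2 _ (cuspDeg_ofSection (surjInv_eq hπ) R)

/-- The same count in `ℕ` (`Set.ncard`). [cite: MochizukiEtTh2009, Prop 5.3 proof p.326–327 (PDF pp.100–101)] -/
theorem IsDegMinimal.ncard_support_eq (hπ : Surjective π) {R : ℤ → ℚ} {h : K → ℚ} (hmin : IsDegMinimal π R h) :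
    (support h).ncard = {i | R i ≠ 0}.ncard := by
  rw [ncard_def, ncard_def, hmin.encard_support_eq hπ]

/-- Degree-minimality may equivalently be tested against FINITELY supported competitors only, with cardinalities in
`ℕ` (the guard-by-finiteness phrasing of "minimal cardinality among the cardinalities of supports").
[cite: MochizukiEtTh2009, Prop 5.3 proof p.326 (PDF p.100)] -/
theorem isDegMinimal_iff_finite {R : ℤ → ℚ} {h : K → ℚ} :
    IsDegMinimal π R h ↔ HasDegrees π R h ∧ (support h).Finite ∧
      ∀ h', HasDegrees π R h' → (support h').Finite → (support h).ncard ≤ (support h').ncard := by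
  constructor
  · rintro ⟨hd, hf, hm⟩
    refine ⟨hd, hf, fun h' hh' hf' => ?_⟩
    have := hm h' hh'
    rw [← hf.cast_ncard_eq, ← hf'.cast_ncard_eq] at this
    exact_mod_cast this
  · rintro ⟨hd, hf, hm⟩
    refine ⟨hd, hf, fun h' hh' => ?_⟩
    rcases (support h').finite_or_infinite with hf' | hinf
    · rw [← hf.cast_ncard_eq, ← hf'.cast_ncard_eq]
      exact_mod_cast hm h' hh' hf'
    · rw [hinf.encard_eq]
      exact le_top

end Literature.AnabelianGeometry.EtaleTheta.ChainDivisors
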